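import Literature.MathematicalPhysics.QuantumFieldTheory.Balaban1983to89.B9Eq379QLipschitzGeneral
import Literature.MathematicalPhysics.QuantumFieldTheory.Balaban1983to89.B9Eq383QSemiLocal
import Literature.MathematicalPhysics.QuantumFieldTheory.Balaban1983to89.B9Eq315QTorusOnto

/-!
# `Balaban1983to89.B9Eq379QLipschitzLocal` — T. Bałaban, *Propagators for lattice gauge theories in a background field*, Commun. Math. Phys.
# **99** (1985) 389–434 [Balaban1985BackgroundPropagators] (3.15) p. 393, (3.79) p. 406, (3.83) p. 407, WITH THE PRINTED LOCALITY of
# [Balaban1985Averaging] p. 24 ∕ p. 34: THE TWO-BACKGROUND `δ_Q`-LETTER `‖Q(U)f − Q(U′)f‖ ≤ δ_Q·‖f‖` ON THE NE9 CHAIN'S WEIGHTED `L²` CARRIERS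
# WITH A CONSTANT INDEPENDENT OF THE VOLUME — `δ_Q = M_φ′·M_φ·√(2d·c₁∕c₀)·75497472(d+1)N·δ` (N = (2d+2)L) in place of
# `B9Eq379QLipschitzGeneral`'s `M_φ′·M_φ·√(c₁·|Bond(T^{(1)})|∕c₀)·75497472(d+1)N·δ`

statement-level skeleton of published theorems with citation tags; proofs where landed; nothing here is a claim
about the Yang–Mills mass gap

CITATION HEADER (lean-in-tree rule 2026-08-18).  Audit cell `pub-balaban`, sub-cell `t4`, NE9 crux team (2): LEAF PROVER 06
(`b2b-balaban-t4-ne9-formalise-leaf-06` gen 62), INTENT I-ne9leaf06-g62-1 (journal `CLAIMS.log` l.43792; first refusal ne9-leaf-04 — author of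
(G)=(δ_Q)₂ `B9Eq379QLipschitzGeneral` (gen 73), of (δ_Q) `B9Eq315QLipschitz` (gen 68) and of the FLAT volume-free letter `B9Eq383QSemiLocal` (gen 69) —
who worded GO, journal l.43925).  THIS FILE IS THE TWO-BACKGROUND TWIN OF `B9Eq383QSemiLocal` §3: that file makes the FLAT letter `‖Q(U)f − Q(1)f‖`
volume-free by the semi-locality of `Q(U)`; the same three devices — `QtorusLin_congr_local` (semi-locality), `sum_sum_near_le` (every fine bond
starts in the block pair of at most `2d` coarse bonds), `norm_le_sqrt_sum_near` — are REUSED BY NAME here on the two-background letter of (G).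
Sources: [B9] = [Balaban1985BackgroundPropagators] (journal page = PDF page + 388), (3.15) p. 393, (3.79) p. 406 (text layer
`paper:balaban1985-cmp99-background-propagators` p0018 read by this seat 2026-08-22: «|F₂(B)B′| ≤ O(1) sup|B| Q″|B′| (3.79) where the averages Q″,
Q‴_j were introduced in [5] by the formulas (140), (141). The constant O(1) above depends only on d and L» — print's own bound is LOCAL in `B′`:
`Q″` is the two-block average (140) of [5]), (3.83) p. 407 («a semi-local operator … with the norm |A′| restricted to the blocks defined above»,
as quoted in `B9Eq383QSemiLocal`); [B7] = [Balaban1985Averaging] p. 24 (after (43)): «this definition is local in the sense that Ū^k_c, c ⊂ Ω^{(k)},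
depends only on the bond variables U_b for b ⊂ B^k(c₋) ∪ B^k(c₊)», p. 34: «(V̿₁)_c is an analytic function of the variables A_b, b ⊂ B(c₋) ∪
B(c₊)» — through the quotations and KERNEL THEOREMS of `B7Prop1Local` (b07), `B7LocalityGeneral` (lit-balaban-r20) and `B9Eq383QSemiLocal`.
Companions (REUSED BY NAME, none modified): `B9Eq379QLipschitzGeneral.norm_QtorusLin_sub_QtorusLin_le` ((3.79) at a general background on the
torus, sup currency), `B9Eq383QSemiLocal.QtorusLin_congr_local` ∕ `sum_sum_near_le` ∕ `norm_le_sqrt_sum_near`, `B9Eq315QTorus.QtorusW_apply`,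
`B9Eq311L2Pairing.WL2.norm_sq`, `B9Eq315QLipschitz.norm_Wcx_sub_one_le`, `B9Eq315QTorusOnto.perSite_liftSite`.

WHY THIS FILE (cell context).  The `aQ*Q` term of the principal gauge-fixed operator (3.26)∕(3.82) of the NE9 chain's `cur` chart
(`B9Eq315QTorus.laplaceAofBackground`) consumes the `δ_Q`-letter `‖Q(U)x − Q(U′)x‖ ≤ δ_Q‖x‖` on the weighted `L²` carriers.  Between TWO backgrounds
the tree's letter (`B9Eq379QLipschitzGeneral` §5∕§6, today) carries the factor `√|Bond(T^{(1)})|` — the number of coarse bonds of the torus — from a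
global sup ↔ `L²` comparison, i.e. it degrades with the VOLUME `m` (its (M3): «NOT uniform in the volume `m` on the `L²` carriers»).  The flat letter
was repaired in `B9Eq383QSemiLocal`; this file repairs the two-background one the same way: per coarse bond the difference `(Q(U)A)(c) − (Q(U′)A)(c)`
depends on `A` only through the fine bonds starting in `B(c₋) ∪ B(c₊)`, and those bond sets cover the fine lattice `2d` times — so the `L²`
transfer costs `√(2d)`, not `√|Bond(T^{(1)})|`.

WHAT IS PROVED (sorry-free; no `Prop` placeholder; no definition; hypotheses = the displayed letters of `B9Eq379QLipschitzGeneral` §4–§6 verbatim).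
* §1 **`norm_QtorusLin_sub_QtorusLin_apply_le_local`** — per coarse bond `c = (y, κ)`, for the base `U′` (unit-bounded, `α′ ≤ 1∕128`-regular
  extended block loops) and `U` with `‖U(b)U′(b)⁻¹ − 1‖ ≤ δ ≤ 1∕(12288N)`: `‖(Q(U)A)(c) − (Q(U′)A)(c)‖ ≤ 75497472(d+1)N·δ·a` for ANY bound
  `a ≥ 0` of `‖A b‖` on the fine bonds `b` starting in `B(y) ∪ B(y + e_κ)` ONLY — (G) §4 at the truncation of `A` to those bonds, which changes
  neither value (`QtorusLin_congr_local` at `U` and at `U′`).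
* §2 **`norm_QtorusW_sub_QtorusW_le_local`** — `‖Q(U)f − Q(U′)f‖ ≤ M_φ′·M_φ·√(2d·c₁∕c₀)·75497472(d+1)N·δ·‖f‖` on the weighted carriers
  (letters of (G) §5 verbatim; NO volume factor): §1 with the local `ℓ²` size `a_c = M_φ·√(Σ_{b near c}‖f(b)‖²)`, squared, weighted by `c₁`,
  re-summed by `sum_sum_near_le`.
* §3 **`norm_QtorusW_sub_QtorusW_le_local_of_bonds`** — the same in the small-bond currency of (G) §6 (`U′(b) ∈ U1`, `‖U′(b) − 1‖ ≤ ε′`,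
  `2(d+1)Lε′ ≤ 1∕128`, `‖U(b) − U′(b)‖ ≤ δ ≤ 1∕(12288N)`).
MODEL / DECLARED READINGS.  (M1) as `B9Eq315QTorus` ∕ `B9Eq379QLipschitzGeneral` ∕ `B9Eq383QSemiLocal`: the torus `TSite d (L·m)` with periodic
extension to `ℤ^d`, one averaging level, `𝔸` a complete normed `ℂ`-algebra with `‖1‖ = 1`, fibre `W` read along `φ`, weights `c₀` (fine), `c₁`
(coarse).  (M2) as (G): the second background carries no hypothesis of its own; the base is unit-bounded and regular; the closeness window
`δ ≤ 1∕(12288N)` is the analyticity radius of (G) §2 (Prop. 7 of [B7] through the tree), not print's.  (M3) constants: `√(2d)` is the covering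
number of `B9Eq383QSemiLocal.card_near_le`; the rest is (G)'s Cauchy-route constant — crude, NOT print's sharp (124)–(126)∕(140) bracket, NOT
optimal; per `(d, L, c₀, c₁, φ)`; INDEPENDENT of the volume `m`; the dependence on the lattice SPACING is (G)'s (none in sup currency; `c₀, c₁` are
the consumer's weights — print: `c₁∕c₀ = L^d`).
HONEST SCOPE.  A finite-lattice continuity letter made volume-free by print's own locality sentence, composed BY NAME from landed theorems; no
inequality of [B7]∕[B9] asserted beyond the tree's theorems; ONE displayed letter of a two-general-backgrounds Lipschitz chart of the NE9 chain, NOT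
that chart, NOT Thm 3.11, NOT NE9; NOT summit progress (cell pub-balaban: NE9 NOT PRINTED ∕ NOT PROVED («NE9 ⇐ the named binders»); row WALLED ON
A MODEL (O-NE9-1); spine PROVED 0∕9; rung (B)+1 on a finite T⁴ — NOT infinite volume, NOT mass gap, NOT Clay).  NEW file importing
`B9Eq379QLipschitzGeneral`, `B9Eq383QSemiLocal`, `B9Eq315QTorusOnto` (for `perSite_liftSite`); nothing of the ne9-leaf-04 ∕ lit-balaban ∕ b07 ∕ NE9-owner lineages' files is modified.
Net new unproved facts: 0.
-/

noncomputable section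

open scoped BigOperators

namespace Literature.MathematicalPhysics.QuantumFieldTheory.Balaban1983to89.B9Eq379QLipschitzLocal

open B4Sect5Torus (TSite)
open B9SectCLatticeCarrier (Bond shift)
open B7Prop1Explicit (U1 Wcx boxVec mem_U1)
open B9Eq319QprimeTorus (fineP blockCoord)
open B9Eq311L2Pairing (WL2)
open B11Eq103H1Complex (BondL2K)
open B9Eq315QTorus (perCfg perCfg_apply perSite cornerSite QtorusLin QtorusW QtorusW_apply)
open B9Eq315QTorusOnto (liftSite perSite_liftSite)
open B9Eq315QLipschitz (norm_Wcx_sub_one_le)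
open B9Eq379QLipschitzGeneral (norm_QtorusLin_sub_QtorusLin_le)
open B9Eq383QSemiLocal (QtorusLin_congr_local sum_sum_near_le norm_le_sqrt_sum_near)

-- `Site` alone would resolve to the torus sites of `Setup.lean`; re-export the `ℤ^d` sites of `B7Prop1Explicit`.
export B7Prop1Explicit (Site)

variable {d : ℕ} {𝔸 : Type*} [NormedRing 𝔸] [NormedAlgebra ℂ 𝔸] [CompleteSpace 𝔸] [NormOneClass 𝔸]

/-! ## §1 The two-background letter per coarse bond with the LOCAL sup of the field -/

section Local

variable (L : ℕ) (m : Fin d → ℕ) [∀ i, NeZero (fineP L m i)] (hL : 1 ≤ L)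
  (U : Bond d (fineP L m) → 𝔸ˣ) {α : ℝ} (hα1 : α ≤ 1 / 64)
  (hU1 : ∀ (x : Site d) (κ : Fin d), perCfg (fineP L m) U x κ ∈ U1 𝔸)
  (hreg : ∀ (y : TSite d m) (κ : Fin d) (r : Fin d → Fin L),
    ‖((Wcx L (perCfg (fineP L m) U) (cornerSite L y) κ (boxVec L r) : 𝔸ˣ) : 𝔸) - 1‖ ≤ α)
  (U' : Bond d (fineP L m) → 𝔸ˣ) {α' : ℝ} (hα1' : α' ≤ 1 / 64)
  (hU1' : ∀ (x : Site d) (κ : Fin d), perCfg (fineP L m) U' x κ ∈ U1 𝔸)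
  (hreg' : ∀ (y : TSite d m) (κ : Fin d) (r : Fin d → Fin L),
    ‖((Wcx L (perCfg (fineP L m) U') (cornerSite L y) κ (boxVec L r) : 𝔸ˣ) : 𝔸) - 1‖ ≤ α')
  (hα' : α' ≤ 1 / 128)
  {δ : ℝ} (hδ : 0 ≤ δ) (hδmax : δ ≤ 1 / (12288 * ((2 * (d * L) + L + L : ℕ) : ℝ)))
  (hUδ : ∀ b : Bond d (fineP L m), ‖((U b : 𝔸ˣ) : 𝔸) * (((U' b)⁻¹ : 𝔸ˣ) : 𝔸) - 1‖ ≤ δ)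

include hα' hδ hδmax hUδ in
/-- **`Q(U)` ON THE TORUS BETWEEN TWO BACKGROUNDS, WITH THE LOCAL SUP OF THE FIELD** (per coarse bond `c = (y, κ)`): for the base `U′`
(unit-bounded, `α′`-regular extended block loops, `α′ ≤ 1∕128`) and `U` with `‖U(b)U′(b)⁻¹ − 1‖ ≤ δ ≤ 1∕(12288N)`,
`‖(Q(U)A)(c) − (Q(U′)A)(c)‖ ≤ 75497472·(d+1)·N·δ·a` for ANY bound `a ≥ 0` of `‖A(b)‖` on the fine bonds `b` STARTING IN `B(y) ∪ B(y + e_κ)` only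
(print (3.83): «with the norm |A′| restricted to the blocks defined above») — `B9Eq379QLipschitzGeneral` §4 at the truncation of `A` to those bonds,
which changes neither value (`B9Eq383QSemiLocal.QtorusLin_congr_local` at `U` and at `U′`).
[cite: Balaban1985BackgroundPropagators, (3.15) p.393, (3.79) p.406, (3.83) p.407; Balaban1985Averaging, p.24, p.34, (122) p.36] -/
theorem norm_QtorusLin_sub_QtorusLin_apply_le_local (A : Bond d (fineP L m) → 𝔸) (c : Bond d m) {a : ℝ} (ha : 0 ≤ a)
    (hA : ∀ b : Bond d (fineP L m), (blockCoord L m b.1 = c.1 ∨ blockCoord L m b.1 = shift c.2 c.1) → ‖A b‖ ≤ a) :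
    ‖QtorusLin L m hL U hα1 hU1 hreg A c - QtorusLin L m hL U' hα1' hU1' hreg' A c‖
      ≤ 75497472 * ((d : ℝ) + 1) * ((2 * (d * L) + L + L : ℕ) : ℝ) * δ * a := by
  classical
  -- the truncation of `A` to the fine bonds starting in `B(c₋) ∪ B(c₊)` (the device of `B9Eq383QSemiLocal` §2)
  set A' : Bond d (fineP L m) → 𝔸 := fun b => if blockCoord L m b.1 = c.1 ∨ blockCoord L m b.1 = shift c.2 c.1 then A b else 0 with hA'def
  have hAA' : ∀ b : Bond d (fineP L m), (blockCoord L m b.1 = c.1 ∨ blockCoord L m b.1 = shift c.2 c.1) → A b = A' b :=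
    fun b hb => by rw [hA'def]; dsimp only; rw [if_pos hb]
  have hA' : ∀ b, ‖A' b‖ ≤ a := fun b => by
    rw [hA'def]; dsimp only
    split_ifs with hb
    · exact hA b hb
    · rw [norm_zero]; exact ha
  rw [QtorusLin_congr_local L m hL U hα1 hU1 hreg c hAA', QtorusLin_congr_local L m hL U' hα1' hU1' hreg' c hAA']
  exact norm_QtorusLin_sub_QtorusLin_le L m hL U hα1 hU1 hreg U' hα1' hU1' hreg' hα' hδ hδmax hUδ A' hA' c

end Local

/-! ## §2 The two-background `δ_Q`-letter on the weighted `L²` carriers with a VOLUME-FREE constant -/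

section Carriers

variable (L : ℕ) (m : Fin d → ℕ) [∀ i, NeZero (fineP L m i)] (hL : 1 ≤ L)
  (U : Bond d (fineP L m) → 𝔸ˣ) {α : ℝ} (hα1 : α ≤ 1 / 64)
  (hU1 : ∀ (x : Site d) (κ : Fin d), perCfg (fineP L m) U x κ ∈ U1 𝔸)
  (hreg : ∀ (y : TSite d m) (κ : Fin d) (r : Fin d → Fin L),
    ‖((Wcx L (perCfg (fineP L m) U) (cornerSite L y) κ (boxVec L r) : 𝔸ˣ) : 𝔸) - 1‖ ≤ α)
  (U' : Bond d (fineP L m) → 𝔸ˣ) {α' : ℝ} (hα1' : α' ≤ 1 / 64)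
  (hU1' : ∀ (x : Site d) (κ : Fin d), perCfg (fineP L m) U' x κ ∈ U1 𝔸)
  (hreg' : ∀ (y : TSite d m) (κ : Fin d) (r : Fin d → Fin L),
    ‖((Wcx L (perCfg (fineP L m) U') (cornerSite L y) κ (boxVec L r) : 𝔸ˣ) : 𝔸) - 1‖ ≤ α')
  (hα' : α' ≤ 1 / 128)
  {δ : ℝ} (hδ : 0 ≤ δ) (hδmax : δ ≤ 1 / (12288 * ((2 * (d * L) + L + L : ℕ) : ℝ)))
  (hUδ : ∀ b : Bond d (fineP L m), ‖((U b : 𝔸ˣ) : 𝔸) * (((U' b)⁻¹ : 𝔸ˣ) : 𝔸) - 1‖ ≤ δ)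
  {W : Type*} [NormedAddCommGroup W] [InnerProductSpace ℂ W] (φ : W ≃ₗ[ℂ] 𝔸) {c₀ c₁ : ℝ} [Fact (0 < c₀)] [Fact (0 < c₁)]
  {Mφ Mφ' : ℝ} (hMφ : 0 ≤ Mφ) (hφ : ∀ w, ‖φ w‖ ≤ Mφ * ‖w‖) (hMφ' : 0 ≤ Mφ') (hφ' : ∀ X, ‖φ.symm X‖ ≤ Mφ' * ‖X‖)

include hα' hδ hδmax hUδ hMφ hφ hMφ' hφ' in
/-- **THE TWO-BACKGROUND `δ_Q`-LETTER ON THE NE9 CHAIN'S CARRIERS, VOLUME-FREE**: `Q(·)` read on the weighted `L²` spaces of `W`-valued bond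
functions (fibre along `φ`, fine weight `c₀`, coarse weight `c₁`; `B9Eq315QTorus.QtorusW`) is Lipschitz in the background between the base `U′`
(unit-bounded, `α′ ≤ 1∕128`-regular) and `U` (`‖U(b)U′(b)⁻¹ − 1‖ ≤ δ ≤ 1∕(12288N)`):
`‖Q(U)f − Q(U′)f‖ ≤ M_φ′·M_φ·√(2d·c₁∕c₀)·75497472(d+1)N·δ·‖f‖` — the statement of `B9Eq379QLipschitzGeneral.norm_QtorusW_sub_QtorusW_le` with
`Fintype.card (Bond d m)` REPLACED BY `2d`, same hypotheses: §1 with the local size `a_c = M_φ·√(Σ_{b near c}‖f(b)‖²)`, squared, summed with the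
coarse weight `c₁`, the double sum re-arranged by `B9Eq383QSemiLocal.sum_sum_near_le` (multiplicity `2d`).  Constants per `(d, L, c₀, c₁, φ)`;
no dependence on the volume `m`.
[cite: Balaban1985BackgroundPropagators, (3.15)–(3.16) p.393, (3.78)–(3.79) p.406, (3.83) p.407; Balaban1985Averaging, p.24, Proposition 7 p.43] -/
theorem norm_QtorusW_sub_QtorusW_le_local (f : BondL2K ℂ d (fineP L m) c₀ W) :
    ‖QtorusW L m hL φ U hα1 hU1 hreg (c₁ := c₁) f - QtorusW L m hL φ U' hα1' hU1' hreg' (c₁ := c₁) f‖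
      ≤ Mφ' * Mφ * Real.sqrt (2 * d * c₁ / c₀) *
          (75497472 * ((d : ℝ) + 1) * ((2 * (d * L) + L + L : ℕ) : ℝ) * δ) * ‖f‖ := by
  classical
  have hc₀ : 0 < c₀ := Fact.out
  have hc₁ : 0 < c₁ := Fact.out
  set K : ℝ := 75497472 * ((d : ℝ) + 1) * ((2 * (d * L) + L + L : ℕ) : ℝ) * δ with hK
  have hK0 : 0 ≤ K := by positivity
  clear_value K
  set fv : Bond d (fineP L m) → W := WL2.equiv ℂ _ W f with hfv
  set g : Bond d (fineP L m) → 𝔸 := fun b => φ (fv b) with hg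
  -- the local `ℓ²` size of `f` around `c`
  set s : Bond d m → ℝ := fun c => Real.sqrt (∑ b ∈ Finset.univ.filter
    (fun b : Bond d (fineP L m) => blockCoord L m b.1 = c.1 ∨ blockCoord L m b.1 = shift c.2 c.1), ‖fv b‖ ^ 2) with hs
  have hs0 : ∀ c, 0 ≤ s c := fun c => Real.sqrt_nonneg _
  have hga : ∀ (c : Bond d m) (b : Bond d (fineP L m)), (blockCoord L m b.1 = c.1 ∨ blockCoord L m b.1 = shift c.2 c.1) →
      ‖g b‖ ≤ Mφ * s c := fun c b hb =>
    (hφ _).trans (mul_le_mul_of_nonneg_left (norm_le_sqrt_sum_near _ fv (by simpa using hb)) hMφ)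
  -- pointwise on the coarse bonds: §1 read back along `φ⁻¹`
  set D := QtorusW L m hL φ U hα1 hU1 hreg (c₁ := c₁) f - QtorusW L m hL φ U' hα1' hU1' hreg' (c₁ := c₁) f with hD
  have hpt : ∀ c : Bond d m, ‖WL2.equiv ℂ _ W D c‖ ≤ Mφ' * (K * (Mφ * s c)) := by
    intro c
    have hloc := norm_QtorusLin_sub_QtorusLin_apply_le_local L m hL U hα1 hU1 hreg U' hα1' hU1' hreg' hα' hδ hδmax hUδ g c
      (mul_nonneg hMφ (hs0 c)) (hga c)
    rw [← hK] at hloc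
    rw [hD, WL2.equiv_sub, Pi.sub_apply, QtorusW_apply, QtorusW_apply, ← map_sub]
    exact (hφ' _).trans (mul_le_mul_of_nonneg_left hloc hMφ')
  -- square and sum with the coarse weight; the block pairs cover the fine bonds `2d` times
  have hl : ‖f‖ ^ 2 = c₀ * ∑ b : Bond d (fineP L m), ‖fv b‖ ^ 2 := by rw [WL2.norm_sq f, Finset.mul_sum]
  have hf : ∑ b : Bond d (fineP L m), ‖fv b‖ ^ 2 = ‖f‖ ^ 2 / c₀ := by rw [eq_div_iff hc₀.ne', hl, mul_comm]
  have hnear : ∑ c : Bond d m, s c ^ 2 ≤ 2 * d * (‖f‖ ^ 2 / c₀) := by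
    have h := sum_sum_near_le L m (fun b : Bond d (fineP L m) => ‖fv b‖ ^ 2) (fun _ => sq_nonneg _)
    rw [hf] at h
    refine le_trans (le_of_eq (Finset.sum_congr rfl fun c _ => ?_)) h
    rw [hs]; exact Real.sq_sqrt (Finset.sum_nonneg fun _ _ => sq_nonneg _)
  have hsq : ‖D‖ ^ 2 ≤ (Mφ' * Mφ * Real.sqrt (2 * d * c₁ / c₀) * K * ‖f‖) ^ 2 := by
    rw [WL2.norm_sq D]
    calc ∑ c : Bond d m, c₁ * ‖WL2.equiv ℂ _ W D c‖ ^ 2 ≤ ∑ c : Bond d m, c₁ * (Mφ' * (K * (Mφ * s c))) ^ 2 :=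
          Finset.sum_le_sum fun c _ => mul_le_mul_of_nonneg_left (pow_le_pow_left₀ (norm_nonneg _) (hpt c) 2) hc₁.le
      _ = c₁ * Mφ' ^ 2 * K ^ 2 * Mφ ^ 2 * ∑ c : Bond d m, s c ^ 2 := by
          rw [Finset.mul_sum]; exact Finset.sum_congr rfl fun c _ => by ring
      _ ≤ c₁ * Mφ' ^ 2 * K ^ 2 * Mφ ^ 2 * (2 * d * (‖f‖ ^ 2 / c₀)) := mul_le_mul_of_nonneg_left hnear (by positivity)
      _ = (Mφ' * Mφ * Real.sqrt (2 * d * c₁ / c₀) * K * ‖f‖) ^ 2 := by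
          have hr : Real.sqrt (2 * d * c₁ / c₀) ^ 2 = 2 * d * c₁ / c₀ := Real.sq_sqrt (by positivity)
          rw [show (Mφ' * Mφ * Real.sqrt (2 * d * c₁ / c₀) * K * ‖f‖) ^ 2 =
              Mφ' ^ 2 * Mφ ^ 2 * Real.sqrt (2 * d * c₁ / c₀) ^ 2 * K ^ 2 * ‖f‖ ^ 2 by ring, hr]
          field_simp
  have h0 : 0 ≤ Mφ' * Mφ * Real.sqrt (2 * d * c₁ / c₀) * K * ‖f‖ := by positivity
  calc ‖D‖ = Real.sqrt (‖D‖ ^ 2) := (Real.sqrt_sq (norm_nonneg _)).symm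
    _ ≤ Real.sqrt ((Mφ' * Mφ * Real.sqrt (2 * d * c₁ / c₀) * K * ‖f‖) ^ 2) := Real.sqrt_le_sqrt hsq
    _ = Mφ' * Mφ * Real.sqrt (2 * d * c₁ / c₀) * K * ‖f‖ := Real.sqrt_sq h0

end Carriers

/-! ## §3 In the chain's small-bond currency: both backgrounds in the ball of bonds near `1` -/

section SmallBonds

omit [NormedAlgebra ℂ 𝔸] [CompleteSpace 𝔸] in
/-- `‖uu′⁻¹ − 1‖ ≤ ‖u − u′‖` for `u′ ∈ U1` (`uu′⁻¹ − 1 = (u − u′)u′⁻¹`, `‖u′⁻¹‖ ≤ 1`). [folklore] -/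
private theorem norm_mul_inv_sub_one_le {u u' : 𝔸ˣ} (hu' : u' ∈ U1 𝔸) :
    ‖(u : 𝔸) * ((u'⁻¹ : 𝔸ˣ) : 𝔸) - 1‖ ≤ ‖(u : 𝔸) - (u' : 𝔸)‖ := by
  have h : (u : 𝔸) * ((u'⁻¹ : 𝔸ˣ) : 𝔸) - 1 = ((u : 𝔸) - (u' : 𝔸)) * ((u'⁻¹ : 𝔸ˣ) : 𝔸) := by
    rw [sub_mul, Units.mul_inv]
  rw [h]
  exact (norm_mul_le _ _).trans (mul_le_of_le_one_right (norm_nonneg _) (mem_U1.1 hu').2)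

variable (L : ℕ) (m : Fin d → ℕ) [∀ i, NeZero (fineP L m i)] (hL : 1 ≤ L)
  (U : Bond d (fineP L m) → 𝔸ˣ) {α : ℝ} (hα1 : α ≤ 1 / 64)
  (hU1 : ∀ (x : Site d) (κ : Fin d), perCfg (fineP L m) U x κ ∈ U1 𝔸)
  (hreg : ∀ (y : TSite d m) (κ : Fin d) (r : Fin d → Fin L),
    ‖((Wcx L (perCfg (fineP L m) U) (cornerSite L y) κ (boxVec L r) : 𝔸ˣ) : 𝔸) - 1‖ ≤ α)
  (U' : Bond d (fineP L m) → 𝔸ˣ) {α' : ℝ} (hα1' : α' ≤ 1 / 64)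
  (hU1' : ∀ (x : Site d) (κ : Fin d), perCfg (fineP L m) U' x κ ∈ U1 𝔸)
  (hreg' : ∀ (y : TSite d m) (κ : Fin d) (r : Fin d → Fin L),
    ‖((Wcx L (perCfg (fineP L m) U') (cornerSite L y) κ (boxVec L r) : 𝔸ˣ) : 𝔸) - 1‖ ≤ α')
  {ε' : ℝ} (hε' : 0 ≤ ε') (hU'ε : ∀ b : Bond d (fineP L m), ‖((U' b : 𝔸ˣ) : 𝔸) - 1‖ ≤ ε')
  (hε'reg : 2 * ((d : ℝ) + 1) * L * ε' ≤ 1 / 128)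
  {δ : ℝ} (hδ : 0 ≤ δ) (hδmax : δ ≤ 1 / (12288 * ((2 * (d * L) + L + L : ℕ) : ℝ)))
  (hUU' : ∀ b : Bond d (fineP L m), ‖((U b : 𝔸ˣ) : 𝔸) - ((U' b : 𝔸ˣ) : 𝔸)‖ ≤ δ)
  {W : Type*} [NormedAddCommGroup W] [InnerProductSpace ℂ W] (φ : W ≃ₗ[ℂ] 𝔸) {c₀ c₁ : ℝ} [Fact (0 < c₀)] [Fact (0 < c₁)]
  {Mφ Mφ' : ℝ} (hMφ : 0 ≤ Mφ) (hφ : ∀ w, ‖φ w‖ ≤ Mφ * ‖w‖) (hMφ' : 0 ≤ Mφ') (hφ' : ∀ X, ‖φ.symm X‖ ≤ Mφ' * ‖X‖)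

include hU1' hε' hU'ε hε'reg hδ hδmax hUU' hMφ hφ hMφ' hφ' in
/-- **THE VOLUME-FREE TWO-BACKGROUND `δ_Q`-LETTER IN THE SMALL-BOND BALL**: for unit-bounded `U′` with `‖U′(b) − 1‖ ≤ ε′`, `2(d+1)L·ε′ ≤ 1∕128`
(so its extended block loops are `2(d+1)Lε′`-regular, `B9Eq315QLipschitz.norm_Wcx_sub_one_le`) and `U` with `‖U(b) − U′(b)‖ ≤ δ ≤ 1∕(12288N)`:
`‖Q(U)f − Q(U′)f‖ ≤ M_φ′·M_φ·√(2d·c₁∕c₀)·75497472(d+1)N·δ·‖f‖` — the currency in which the NE9 chain's small-bond ball (`‖U(b) − 1‖ ≤ ε ≤ ε₃ ≤ ε_reg(d,L)`)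
discharges the letters for both backgrounds (`B9Eq379QLipschitzGeneral.norm_QtorusW_sub_QtorusW_le_of_bonds` with the volume factor removed).
[cite: Balaban1985BackgroundPropagators, (3.78)–(3.79) p.406, (3.83) p.407, Thm 3.11 p.416; Balaban1985Averaging, p.24, Proposition 7 p.43] -/
theorem norm_QtorusW_sub_QtorusW_le_local_of_bonds (f : BondL2K ℂ d (fineP L m) c₀ W) :
    ‖QtorusW L m hL φ U hα1 hU1 hreg (c₁ := c₁) f - QtorusW L m hL φ U' hα1' hU1' hreg' (c₁ := c₁) f‖
      ≤ Mφ' * Mφ * Real.sqrt (2 * d * c₁ / c₀) *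
          (75497472 * ((d : ℝ) + 1) * ((2 * (d * L) + L + L : ℕ) : ℝ) * δ) * ‖f‖ := by
  -- the base's extended block loops are `2(d+1)Lε′`-regular, read off its bonds
  have hU'p : ∀ (x : Site d) (κ : Fin d), ‖((perCfg (fineP L m) U' x κ : 𝔸ˣ) : 𝔸) - 1‖ ≤ ε' := fun x κ => hU'ε _
  have hregε : ∀ (y : TSite d m) (κ : Fin d) (r : Fin d → Fin L),
      ‖((Wcx L (perCfg (fineP L m) U') (cornerSite L y) κ (boxVec L r) : 𝔸ˣ) : 𝔸) - 1‖ ≤ 2 * (d + 1) * L * ε' :=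
    fun y κ r => norm_Wcx_sub_one_le hU1' hU'p L (cornerSite L y) κ r hε'
  -- the closeness letter from the bondwise distance (`U′(b) ∈ U1` through the extension at the representative of `b`)
  have hU1b : ∀ b : Bond d (fineP L m), U' b ∈ U1 𝔸 := fun b => by
    have h := hU1' (liftSite b.1) b.2
    rwa [perCfg_apply, perSite_liftSite] at h
  have hUδ : ∀ b : Bond d (fineP L m), ‖((U b : 𝔸ˣ) : 𝔸) * (((U' b)⁻¹ : 𝔸ˣ) : 𝔸) - 1‖ ≤ δ := fun b =>
    (norm_mul_inv_sub_one_le (hU1b b)).trans (hUU' b)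
  -- §2 with the base's regularity letter `2(d+1)Lε′ ≤ 1∕128` (the value of `QtorusW … U′ …` is letter-free)
  exact norm_QtorusW_sub_QtorusW_le_local L m hL U hα1 hU1 hreg U' (α' := 2 * (d + 1) * L * ε') (hε'reg.trans (by norm_num)) hU1'
    hregε hε'reg hδ hδmax hUδ φ (c₀ := c₀) (c₁ := c₁) hMφ hφ hMφ' hφ' f

end SmallBonds

end Literature.MathematicalPhysics.QuantumFieldTheory.Balaban1983to89.B9Eq379QLipschitzLocal

end
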